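import Summits.ResolutionOfSingularities.ResolutionOfSingularities.Theorems.PurelyInseparableDim4IsolatedScope
import Summits.ResolutionOfSingularities.ResolutionOfSingularities.Theorems.PurelyInseparableDim4IsolatedMeasure
import Summits.ResolutionOfSingularities.ResolutionOfSingularities.Theorems.PurelyInseparableDim4IsolatedCleaning
import Summits.ResolutionOfSingularities.ResolutionOfSingularities.Theorems.PurelyInseparableDim4SpineTerminates
import Summits.ResolutionOfSingularities.ResolutionOfSingularities.Theorems.PurelyInseparableDim4RuleS
import Summits.ResolutionOfSingularities.ResolutionOfSingularities.Theorems.PurelyInseparableDim4Perm2BoundOrigin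
import Summits.ResolutionOfSingularities.ResolutionOfSingularities.Theorems.PurelyInseparableDim4NearDim
import HarnessLib

/-!
# [OURS · res-dim4-pi · F4-C] SCOPE DYNAMICS, part 1: `TerminatesInScope` REDUCES TO THE TRANSLATED EDGES,
  and the Hasse-derivative algebra of a divisor step (`J_p⁺(x_j^p · G) = x_j^p · J_p⁺(G)`)

Cell `res-dim4-pi` (D-0157 DOOR 2, wave 2), seat `res-dim4-p-6`, desk WORD #31 (c) (brick «SCOPE DYNAMICS», F4-C);
the F4-C analogue of p-9's `IsoSpine.noIsolatedTrap_of_rank` (`PurelyInseparableDim4IsoSpineReduction`).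
Frame v4 (`PurelyInseparableDim4Scope`): F4-C `TerminatesInScope p q` = over every field of characteristic `p`
SOME permissible coordinate rule has no infinite branch all of whose states are IN COORDINATE SCOPE.  With F4-S
a tree theorem (`spineTerminatesSomeRule_of_pos`, p-10: some permissible rule has no infinite SPINE branch,
every `q > 0`), an infinite in-scope branch of such a rule has TRANSLATED edges (`b ≠ 0`) beyond every time;
so a letter that never recharges along in-scope edges of that rule and pays on its translated in-scope edges
closes F4-C.  No such letter is asserted here.

* §1 `exists_translated_of_branch` — under a spine-terminating rule every infinite branch has a non-spine edge
  beyond every time; `spine_tail_or_translated_io` (pure logic).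
* §2 **`no_inScope_branch_of_rank`** (one field, well-ordered letter), **`terminatesInScope_of_spine_and_rank`**
  (frame form: `∃ R` permissible ∧ spine-terminating ∧ a well-ordered letter `Φ : State K → W` non-increasing on
  in-scope `R`-edges, strictly decreasing on the translated ones ⇒ `TerminatesInScope p q`),
  **`terminatesInScope_of_rank_ruleS`** (the spine hypothesis DISCHARGED for the CONCRETE rule of record, p-11's
  MODE S `ruleS q`, `q > 0`: it suffices to price the translated in-scope MODE-S edges), `terminatesInScope_of_rank`.  Honest remark: F4-I (isolated states, WildCones bridge) does not simply
  factor out of F4-C — translated edges of an in-scope branch may all sit at isolated states while the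
  non-isolated states only see spine edges — so the letter must be monotone across isolated edges too
  (a two-letter form needs a gluing hypothesis; not typed here).
* §3 the DIVISOR-STEP ALGEBRA at `q = p`: `natCast_choose_add_prime` (Lucas periodicity `C(n+p,k) ≡ C(n,k)`,
  `k < p`), **`hasseDeriv_X_pow_mul`** (`D^{(α)}(x_j^p G) = x_j^p D^{(α)}G` for `|α| < p`),
  **`singLocusIdeal_X_pow_mul`** (`J_p⁺(x_j^p · G) = (x_j^p) · J_p⁺(G)`), and the spine DIV edge:
  **`singLocusIdeal_eq_span_mul_step`** — for a clean state with the divisor `{j}` permissible, `J_p⁺(F) =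
  (x_j^p) · J_p⁺(F′)` where `F′ = (step p {j} j 0 s).F` (the DIV step IS division by `x_j^p`: p-3's
  `NearDim.X_pow_mul_chartTransform_singleton`, p-2's `Perm2Bound.step_F_origin`).  Reading: the child's `p`-fold
  locus is the parent's with the hyperplane `V(x_j)` removed — components of the child INSIDE `V(x_j)` were not
  minimal for the parent, so «in scope» is not inherited along DIV edges in general (specimen: part 2).

[OURS · counted 0 · elementary · AI kernel work, weaker than expert review.]  NOTHING here is a statement about
resolution of singularities; resolution in dimension `≥ 4` / characteristic `p > 0` is NOT proved by anything
in this file.  bears_on: LADDER-RESOLUTION:D157-DOOR2 (res-dim4-pi · F4-C).  Host item: `stmt-ResolutionOfSingularities-16155`.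
-/

noncomputable section

set_option linter.dupNamespace false -- mandated namespace of this single-conjunct summit

open MvPolynomial Finset

open scoped BigOperators

namespace Summit.ResolutionOfSingularities.ResolutionOfSingularities.Theorems.PIDim4

namespace ScopeDynamics

open Literature.AlgebraicGeometry.Resolution
open Literature.AlgebraicGeometry.Resolution.CentreBlowup
open Literature.AlgebraicGeometry.Resolution.Hauser2010

variable {K : Type} [Field K] [DecidableEq K]

/-! ## §1 Tails of a branch under a spine-terminating rule -/

/-- Pure logic: an infinite branch either has an all-spine tail or non-spine (translated) edges beyond every
time. [folklore] -/
theorem spine_tail_or_translated_io (q : ℕ) (R : CentreRule K) (c : ℕ → State K) :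
    (∃ N, ∀ k, N ≤ k → SpineEdge q (R (c k)) (c k) (c (k + 1))) ∨
      ∀ N, ∃ k, N ≤ k ∧ ¬ SpineEdge q (R (c k)) (c k) (c (k + 1)) := by
  by_cases h : ∃ N, ∀ k, N ≤ k → SpineEdge q (R (c k)) (c k) (c (k + 1))
  · exact Or.inl h
  · push Not at h
    exact Or.inr h

/-- **Under a spine-terminating rule every infinite branch has a translated edge beyond every time**
(otherwise a tail would be an all-spine branch of the rule). [folklore] -/
theorem exists_translated_of_branch (q : ℕ) (R : CentreRule K) (hRS : SpineTerminatesUnder q R)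
    (c : ℕ → State K) (hc : ∀ k, StepRule q R (c k) (c (k + 1))) (N : ℕ) :
    ∃ k, N ≤ k ∧ ¬ SpineEdge q (R (c k)) (c k) (c (k + 1)) := by
  by_contra h
  push Not at h
  refine hRS ⟨fun k => c (N + k), fun k => ⟨(hc (N + k)).1, ?_⟩⟩
  show SpineEdge q (R (c (N + k))) (c (N + k)) (c (N + (k + 1)))
  rw [← Nat.add_assoc]
  exact h (N + k) (Nat.le_add_right N k)

/-! ## §2 F4-C reduces to the translated in-scope edges -/

/-- **Single-field reduction.**  If `R` has no infinite spine branch and a letter `Φ` with values in a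
well-order never increases along `R`-edges between in-scope states and strictly decreases along the
translated ones, then `R` has no infinite in-scope branch over `K`. [folklore] -/
theorem no_inScope_branch_of_rank {W : Type} [LinearOrder W] [WellFoundedLT W] (q : ℕ) (R : CentreRule K)
    (hRS : SpineTerminatesUnder q R) (Φ : State K → W)
    (hle : ∀ s s' : State K, InCoordinateScope q s.F → InCoordinateScope q s'.F → StepRule q R s s' → Φ s' ≤ Φ s)
    (hlt : ∀ s s' : State K, InCoordinateScope q s.F → InCoordinateScope q s'.F → StepRule q R s s' →
      ¬ SpineEdge q (R s) s s' → Φ s' < Φ s) :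
    ¬ ∃ c : ℕ → State K, ∀ k, InCoordinateScope q (c k).F ∧ StepRule q R (c k) (c (k + 1)) := by
  rintro ⟨c, hc⟩
  have hmono : ∀ k, Φ (c (k + 1)) ≤ Φ (c k) := fun k =>
    hle _ _ (hc k).1 (hc (k + 1)).1 (hc k).2
  obtain ⟨T, hT⟩ := IsolatedMeasure.eventually_const_of_succ_le (fun k => Φ (c k)) hmono
  obtain ⟨k, hk, hnot⟩ := exists_translated_of_branch q R hRS c (fun k => (hc k).2) T
  have hdrop := hlt _ _ (hc k).1 (hc (k + 1)).1 (hc k).2 hnot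
  have h1 : Φ (c k) = Φ (c T) := hT k hk
  have h2 : Φ (c (k + 1)) = Φ (c T) := hT (k + 1) (by omega)
  rw [h1, h2] at hdrop
  exact lt_irrefl _ hdrop

/-- **F4-C REDUCES TO THE TRANSLATED EDGES** (frame form): if over every field of characteristic `p` some
permissible coordinate rule has no infinite spine branch AND carries a letter with values in a well-order that
never increases along its in-scope edges and strictly decreases along its translated in-scope edges, then
`PIDim4.TerminatesInScope p q`.  (Well-order `W` arbitrary, so lex letters `(Φ_C, Φ_I)` need no re-proof —
K-second res-dim4-p-14.) [folklore] -/
theorem terminatesInScope_of_spine_and_rank (p q : ℕ)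
    (h : ∀ (K : Type) [Field K] [CharP K p] [DecidableEq K],
      ∃ R : CentreRule K, IsPermissibleRule q R ∧ SpineTerminatesUnder q R ∧
        ∃ (W : Type) (_ : LinearOrder W) (_ : WellFoundedLT W) (Φ : State K → W),
          (∀ s s' : State K, InCoordinateScope q s.F → InCoordinateScope q s'.F → StepRule q R s s' →
            Φ s' ≤ Φ s) ∧
          (∀ s s' : State K, InCoordinateScope q s.F → InCoordinateScope q s'.F → StepRule q R s s' →
            ¬ SpineEdge q (R s) s s' → Φ s' < Φ s)) :
    TerminatesInScope p q := by
  intro K _ _ _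
  obtain ⟨R, hR, hRS, W, _, _, Φ, hle, hlt⟩ := h K
  exact ⟨R, hR, no_inScope_branch_of_rank q R hRS Φ hle hlt⟩

/-- **F4-C FROM A LETTER FOR MODE S** (the concrete rule of record, K-second res-dim4-p-14): p-11's state-level
Spivakovsky rule `ruleS q` is permissible and wins the spine game for `q > 0` (`SpineRuleS.isPermissibleRule_ruleS`,
`SpineRuleS.spineTerminatesUnder_ruleS`); so `TerminatesInScope p q` follows from a well-ordered letter that never
increases along in-scope MODE-S edges and strictly decreases along the translated ones.  No such letter is
asserted here. [folklore] -/
theorem terminatesInScope_of_rank_ruleS (p : ℕ) {q : ℕ} (hq : 0 < q)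
    (h : ∀ (K : Type) [Field K] [CharP K p] [DecidableEq K],
      ∃ (W : Type) (_ : LinearOrder W) (_ : WellFoundedLT W) (Φ : State K → W),
        (∀ s s' : State K, InCoordinateScope q s.F → InCoordinateScope q s'.F →
          StepRule q (ruleS q) s s' → Φ s' ≤ Φ s) ∧
        (∀ s s' : State K, InCoordinateScope q s.F → InCoordinateScope q s'.F →
          StepRule q (ruleS q) s s' → ¬ SpineEdge q (ruleS q s) s s' → Φ s' < Φ s)) :
    TerminatesInScope p q :=
  terminatesInScope_of_spine_and_rank p q fun K _ _ _ =>
    ⟨ruleS q, SpineRuleS.isPermissibleRule_ruleS hq, SpineRuleS.spineTerminatesUnder_ruleS hq, h K⟩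

/-- The ∀-rule variant: `SpineTerminatesSomeRule p q` (F4-S) plus a letter for EVERY permissible
spine-terminating rule also gives `TerminatesInScope p q` (weaker hypothesis shape than needed; recorded for
completeness). [folklore] -/
theorem terminatesInScope_of_rank (p q : ℕ) (hS : SpineTerminatesSomeRule p q)
    (h : ∀ (K : Type) [Field K] [CharP K p] [DecidableEq K] (R : CentreRule K),
      IsPermissibleRule q R → SpineTerminatesUnder q R →
        ∃ (W : Type) (_ : LinearOrder W) (_ : WellFoundedLT W) (Φ : State K → W),
          (∀ s s' : State K, InCoordinateScope q s.F → InCoordinateScope q s'.F → StepRule q R s s' →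
            Φ s' ≤ Φ s) ∧
          (∀ s s' : State K, InCoordinateScope q s.F → InCoordinateScope q s'.F → StepRule q R s s' →
            ¬ SpineEdge q (R s) s s' → Φ s' < Φ s)) :
    TerminatesInScope p q := by
  refine terminatesInScope_of_spine_and_rank p q fun K _ _ _ => ?_
  obtain ⟨R, hR, hRS⟩ := hS K
  exact ⟨R, hR, hRS, h K R hR hRS⟩

/-- Reading of an infinite in-scope branch of a spine-terminating rule: translated edges occur beyond every
time. [folklore] -/
theorem exists_translated_of_inScope_branch (q : ℕ) (R : CentreRule K) (hRS : SpineTerminatesUnder q R)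
    (c : ℕ → State K) (hc : ∀ k, InCoordinateScope q (c k).F ∧ StepRule q R (c k) (c (k + 1))) (N : ℕ) :
    ∃ k, N ≤ k ∧ ¬ SpineEdge q (R (c k)) (c k) (c (k + 1)) :=
  exists_translated_of_branch q R hRS c (fun k => (hc k).2) N

/-! ## §3 The divisor-step algebra at `q = p` -/

omit [DecidableEq K] in
/-- **Lucas periodicity**: `C(n + p, k) = C(n, k)` in characteristic `p` for `k < p`
(both `≡ C(n mod p, k)`). [folklore] -/
theorem natCast_choose_add_prime (p : ℕ) [hp : Fact p.Prime] [CharP K p] (n : ℕ) {k : ℕ} (hk : k < p) :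
    (Nat.choose (n + p) k : K) = (Nat.choose n k : K) := by
  have h1 := Choose.choose_modEq_choose_mod_mul_choose_div_nat (n := n + p) (k := k) (p := p)
  have h2 := Choose.choose_modEq_choose_mod_mul_choose_div_nat (n := n) (k := k) (p := p)
  rw [Nat.mod_eq_of_lt hk, Nat.div_eq_of_lt hk, Nat.choose_zero_right, mul_one] at h1 h2
  rw [Nat.add_mod_right] at h1
  exact (CharP.natCast_eq_natCast K p).mpr (h1.trans h2.symm)

omit [DecidableEq K] in
/-- In characteristic `p`: `C(m, k) = 0` in `K` when `p ≤ m`, `m < p + k` and `k < p` (the lowest digit of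
`m` is `m − p < k`). [folklore] -/
theorem natCast_choose_eq_zero_of_window (p : ℕ) [hp : Fact p.Prime] [CharP K p] {m k : ℕ} (hpm : p ≤ m)
    (hmk : m < p + k) (hk : k < p) : (Nat.choose m k : K) = 0 := by
  obtain ⟨n, rfl⟩ := Nat.exists_eq_add_of_le hpm
  rw [add_comm, natCast_choose_add_prime p n hk, Nat.choose_eq_zero_of_lt (by omega), Nat.cast_zero]

omit [DecidableEq K] in
/-- A coordinate of `α` is at most its degree. [folklore] -/
theorem apply_le_degree (α : Fin 4 →₀ ℕ) (j : Fin 4) : α j ≤ α.degree := by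
  rw [Finsupp.degree_eq_sum]
  exact Finset.single_le_sum (fun i _ => Nat.zero_le (α i)) (Finset.mem_univ j)

omit [DecidableEq K] in
/-- **Hasse derivatives of order `< p` commute with multiplication by `x_j^p`**:
`D^{(α)}(x_j^p · G) = x_j^p · D^{(α)} G` for `|α| < p` (Leibniz + Lucas: `D^{(β)} x_j^p = C(p, β_j) x_j^{p−β_j}
= 0` for `0 < β_j < p`; proved on coefficients). [cite: Giraud1975, §1 (Hasse–Schmidt derivations)] [folklore] -/
theorem hasseDeriv_X_pow_mul (p : ℕ) [Fact p.Prime] [CharP K p] (j : Fin 4) (G : MvPolynomial (Fin 4) K)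
    {α : Fin 4 →₀ ℕ} (hα : α.degree < p) :
    hasseDeriv α ((X j : MvPolynomial (Fin 4) K) ^ p * G) = (X j : MvPolynomial (Fin 4) K) ^ p * hasseDeriv α G := by
  classical
  have hαj : α j < p := lt_of_le_of_lt (apply_le_degree α j) hα
  ext e
  rw [IsolatedBand.coeff_hasseDeriv, X_pow_eq_monomial, coeff_monomial_mul', coeff_monomial_mul', one_mul,
    one_mul]
  by_cases hej : p ≤ e j
  · -- the honest case: both sides read the coefficient of `x^{e + α − p e_j}` in `G`
    have hle1 : Finsupp.single j p ≤ e + α := by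
      rw [Finsupp.single_le_iff, Finsupp.add_apply]; omega
    have hle2 : Finsupp.single j p ≤ e := Finsupp.single_le_iff.mpr hej
    rw [if_pos hle1, if_pos hle2, IsolatedBand.coeff_hasseDeriv]
    have hsub : e + α - Finsupp.single j p = e - Finsupp.single j p + α := by
      ext i
      simp only [Finsupp.tsub_apply, Finsupp.add_apply, Finsupp.single_apply]
      by_cases h : j = i
      · rw [if_pos h]; subst h; omega
      · rw [if_neg h]; omega
    rw [hsub]
    congr 1
    refine Finset.prod_congr rfl fun i _ => ?_
    simp only [Finsupp.tsub_apply, Finsupp.single_apply]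
    by_cases h : j = i
    · rw [if_pos h]
      have hαi : α i < p := lt_of_le_of_lt (apply_le_degree α i) hα
      have hei : p ≤ e i := h ▸ hej
      have : e i + α i = (e i - p + α i) + p := by omega
      rw [this, natCast_choose_add_prime p _ hαi]
    · rw [if_neg h, Nat.sub_zero]
  · rw [if_neg (show ¬ Finsupp.single j p ≤ e from fun h => hej (Finsupp.single_le_iff.mp h))]
    by_cases hej' : Finsupp.single j p ≤ e + α
    · -- `e_j < p ≤ e_j + α_j`: the binomial at `j` vanishes (Lucas)
      rw [if_pos hej']
      have hpj : p ≤ e j + α j := by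
        have := Finsupp.single_le_iff.mp hej'
        rwa [Finsupp.add_apply] at this
      have hz : (Nat.choose (e j + α j) (α j) : K) = 0 :=
        natCast_choose_eq_zero_of_window p hpj (by omega) hαj
      rw [Finset.prod_eq_zero (Finset.mem_univ j) hz, zero_mul]
    · rw [if_neg hej', mul_zero]

omit [DecidableEq K] in
/-- **`J_p⁺(x_j^p · G) = (x_j^p) · J_p⁺(G)`** (generators correspond by `hasseDeriv_X_pow_mul`).
[cite: Giraud1975, §1] [folklore] -/
theorem singLocusIdeal_X_pow_mul (p : ℕ) [Fact p.Prime] [CharP K p] (j : Fin 4) (G : MvPolynomial (Fin 4) K) :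
    singLocusIdeal p ((X j : MvPolynomial (Fin 4) K) ^ p * G) =
      Ideal.span {(X j : MvPolynomial (Fin 4) K) ^ p} * singLocusIdeal p G := by
  unfold singLocusIdeal
  rw [Ideal.span_mul_span', Set.singleton_mul]
  congr 1
  ext H
  constructor
  · rintro ⟨α, h0, hq, rfl⟩
    exact ⟨hasseDeriv α G, ⟨α, h0, hq, rfl⟩, (hasseDeriv_X_pow_mul p j G hq).symm⟩
  · rintro ⟨_, ⟨α, h0, hq, rfl⟩, rfl⟩
    exact ⟨α, h0, hq, (hasseDeriv_X_pow_mul p j G hq).symm⟩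

/-- **The spine DIV edge on ideals.**  For a CLEAN state with the divisor `{j}` Hironaka-permissible
(`p ≤ ord_{(x_j)} F`), the step along `{j}` read at the chart origin IS division by `x_j^p`
(`F = x_j^p · F′`), hence `J_p⁺(F) = (x_j^p) · J_p⁺(F′)`: the child's `p`-fold locus is the parent's with the
hyperplane `V(x_j)` removed. [folklore] -/
theorem singLocusIdeal_eq_span_mul_step (p : ℕ) [Fact p.Prime] [CharP K p] {j : Fin 4} (s : State K)
    (hclean : deletePthPowers p s.F = s.F) (hperm : (p : ℕ∞) ≤ ordAlong {j} s.F) :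
    singLocusIdeal p s.F =
      Ideal.span {(X j : MvPolynomial (Fin 4) K) ^ p} *
        singLocusIdeal p (CentreBlowup.step p {j} j (0 : Fin 4 → K) s).F := by
  have hq : ∀ e ∈ s.F.support, p ≤ degIn {j} e := NearDim.forall_le_degIn_of_le_ordAlong hperm
  rw [Perm2Bound.step_F_origin (Finset.mem_singleton_self j) (0 : Fin 4 → K) (fun _ => rfl) s hclean hq,
    ← singLocusIdeal_X_pow_mul p j, NearDim.X_pow_mul_chartTransform_singleton hperm]

end ScopeDynamics

end Summit.ResolutionOfSingularities.ResolutionOfSingularities.Theorems.PIDim4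

end
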